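import Literature.AlgebraicGeometry.Motives.SupersingularLefschetzOfNoncommutative
import HarnessLib

/-!
# Lenstra–Zarhin for supersingular abelian varieties: the single residual input, named

Topic `Literature/AlgebraicGeometry/Motives`. The named fact
`LenstraZarhin1993_supersingular_lefschetzClasses_eq_top W A` (`SupersingularAbelianVariety.lean`;
Lenstra–Zarhin 1993 §1: on a supersingular abelian variety over `k = k̄` every class of `H²ʳ` is
a Lefschetz class) hit the literature-prover budget cap; its seat PROVED the whole argument
(`A ∼ Eᵍ`, `H•(Eᵍ) = ⋀•H¹`, divisor classes from `End E`, polarization, transfer along isogenies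
and base change; files `SupersingularAbelianVarietyProofs`, `LefschetzClasses*`,
`SupersingularLefschetzOfDeuring`, `SupersingularLefschetzOfNoncommutative`, and the characteristic
`0` case outright) up to ONE classical input:
`LenstraZarhin1993_supersingular_lefschetzClasses_eq_top_of_noncommutative` takes as hypothesis
that a supersingular elliptic curve has two non-commuting endomorphisms.

That input is **Deuring's theorem** (M. Deuring, *Die Typen der Multiplikatorenringe
elliptischer Funktionenkörper*, Abh. Math. Sem. Hamburg 14 (1941); Silverman, *AEC* (2009),
Thm. V.3.1 (a): for `E` over a field of characteristic `p > 0`, `E[pʳ] = 0` for one (all) `r ≥ 1`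
iff `End(E)` is an order in a quaternion algebra — in particular `End(E)` is non-commutative),
which this file records as the named fact `Deuring1941_supersingular_exists_mul_ne_mul` in exactly
the weak form the assembly consumes (existence of two non-commuting endomorphisms), and
`LenstraZarhin1993_supersingular_lefschetzClasses_eq_top_holds_of` PROVES the parent from it.
The child does not restate the parent: it is a statement about endomorphism rings of elliptic
curves, with no cohomology in it.

## References

* [LenstraZarhin1993] H. W. Lenstra, Yu. G. Zarhin, The Tate conjecture for almost ordinary
  abelian varieties over finite fields, in: Advances in Number Theory (1993), §1 pp. 179–180.
* [SilvermanAEC2009] J. H. Silverman, The Arithmetic of Elliptic Curves, 2nd ed., GTM 106 (2009),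
  Thm. V.3.1 (a) (Deuring).
-/

noncomputable section

universe u v

open CategoryTheory AlgebraicGeometry

namespace Literature.AlgebraicGeometry.Motives

/-- **Deuring 1941 (Silverman, AEC Thm. V.3.1 (a), (i) ⇒ (iv)): the endomorphism ring of a
supersingular elliptic curve is non-commutative.** For an algebraically closed field `k` and a
one-dimensional abelian variety `E/k` with `E[p](k̄) = 0`, `p = char k`
(`AbelianVariety.IsSupersingularEllipticCurve`; vacuous in characteristic `0`, where no curve is
supersingular, `not_isSupersingularEllipticCurve_of_ringChar_eq_zero`), there are endomorphisms
`f, g ∈ End(E)` with `f g ≠ g f` — printed: "`End(E)` is an order in a quaternion algebra". The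
weak form consumed by `LenstraZarhin1993_supersingular_lefschetzClasses_eq_top_of_noncommutative`.
[cite: SilvermanAEC2009, Thm. V.3.1 (a)] -/
def Deuring1941_supersingular_exists_mul_ne_mul : Prop :=
  ∀ (k : Type u) [Field k] [IsAlgClosed k] (E : AbelianVariety k),
    E.IsSupersingularEllipticCurve → ∃ f g : End E, f * g ≠ g * f

variable {k : Type u} [Field k] {K : Type v} [Field K] [CharZero K] (W : WeilCohomology k K)
  (A : AbelianVariety k)

/-- **Assembly: Lenstra–Zarhin from Deuring.** Deuring's theorem (applied over
`k̄ = AlgebraicClosure k`) is the hypothesis of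
`LenstraZarhin1993_supersingular_lefschetzClasses_eq_top_of_noncommutative`; everything else in
Lenstra–Zarhin's argument is a theorem of the tree. [cite: LenstraZarhin1993, §1 pp. 179–180]
[cite: SilvermanAEC2009, Thm. V.3.1 (a)] -/
theorem LenstraZarhin1993_supersingular_lefschetzClasses_eq_top_holds_of
    (h : Deuring1941_supersingular_exists_mul_ne_mul.{u}) :
    LenstraZarhin1993_supersingular_lefschetzClasses_eq_top W A :=
  LenstraZarhin1993_supersingular_lefschetzClasses_eq_top_of_noncommutative W A
    fun E hE ↦ h (AlgebraicClosure k) E hE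

end Literature.AlgebraicGeometry.Motives

end
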